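import Summits.NavierStokesRegularity.NavierStokesRegularity.Theorems.ScenarioCensusLargeOrderRigidity
import Literature.Analysis.FluidPDE.AxisymmetricVorticityTransport
import HarnessLib.Audit

/-!
# Scenario census, row F13mL (`ScenarioCensus.Row_F13mLarge`) at bounded critical budget: a REDUCTION (census-merge) theorem —
# `row_F13mLargeL3_of : AxisymL3LerayRegular → Row_F13mLargeL3` and the sandwich `AxisymL3LerayRegular ⟹ Row_F13mLargeL3 ⟹ Row_F5`

Port (typer seat ns-census-typer-1 g6; lead g8 GO 2026-08-28T18:02Z [2/3] «optional (3) RowF13mLargeL3, reduction, no value change»)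
of the ideator's tree-ready kit file 3 `pub/ideators/ns-idea-9/lines/dihedral_noswirl/landing/ScenarioCensusRowF13mLargeL3.lean`
(sha16 6b4d9e333826e9de, 266 l.) = ns-idea-9 LINE 13 «sector_budget» rev 3 (HOME `lines/sector_budget/sector_budget.lean`
eab4a18d41408bc5; critic idea-crit-8 g3 verdict V55 PASS «reduction / census-merge theorem») VERBATIM, re-namespaced, with the shared
S2 machinery taken from typer-2 g8's port of kit file 1 (`Theorems/ScenarioCensusLargeOrderRigidity.lean`, namespace
`…ScenarioCensus.LargeOrderRigidity`) instead of repeated.  The only edit: the kit's `local notation "ℝ³"` is spelled with the tree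
abbreviation `LargeOrderRigidity.R3` (typer lint: no notation).  Nothing accepted in the tree is restated or changed.

`Row_F13mLargeL3` := row F13m's frame VERBATIM at orders `m ≥ m₀(ν, K)` PLUS the critical budget `‖u 0‖_{L³} ≤ K ν`.  It is NOT proved:
it is reduced to the OPEN residual `AxisymL3LerayRegular` (axisymmetric-WITH-swirl regularity of local Leray solutions from `L³` data —
the catalogued swirl wall, stated as a hypothesis, never asserted), by S1 `normalisedBadSequence` + the tree's weak-`L³` stability of local
Leray solutions with stability of singular points + S2 `profileRigidity` (from `LargeOrderRigidity.profileRigidity_of`: the weak limit of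
`C_{m_j}`-equivariant budgeted data with `m_j → ∞` is a.e.-axisymmetric about some vertical axis).  Conversely the cell implies row F5
(`row_F5_of_row_F13mLargeL3`: an axisymmetric datum is `C_m`-symmetric for every `m` and a rapidly decaying Leray–Hopf datum has a finite
budget), so the budgeted large-order cell and axisymmetric-with-swirl regularity are MERGED for census purposes (census lattice edge
`row_F13mLargeL3_of_row_F13mLarge`, CENSUS-FINAL §2).  A REDUCTION, not an exclusion: no census value changes.
**NOT THE ROW:** `Row_F13mLarge`, `Row_F5`, `Row_F0` stay OPEN; NS regularity is NOT proved; no summit statement is proved here.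
-/

noncomputable section

set_option linter.dupNamespace false
set_option linter.unusedVariables false

open Set Function Filter Topology MeasureTheory Metric TopologicalSpace
open scoped NNReal ENNReal RealInnerProductSpace

namespace Summit.NavierStokesRegularity.NavierStokesRegularity.Theorems.ScenarioCensus.RowF13mLargeL3

open Literature.Analysis Literature.Analysis.FluidPDE
open Summit.NavierStokesRegularity.NavierStokesRegularity.Theorems.ScenarioCensus
open Summit.NavierStokesRegularity.NavierStokesRegularity.Theorems.ScenarioCensus.LargeOrderRigidity


/-! ## The cell and its residual (the residual is an OPEN hypothesis, not asserted) -/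

/-- **The cell of LINE 13** (budgeted large-order cell): for every `ν > 0` and budget `K` there is an
order `m₀` such that, for `m ≥ m₀`, Row F13m's frame VERBATIM plus `‖u 0‖_{L³} ≤ K ν` gives extension
past `T`.  OPEN — nothing asserted. -/
def Row_F13mLargeL3 : Prop :=
  ∀ (ν K : ℝ), 0 < ν → ∃ m₀ : ℕ, ∀ m : ℕ, m₀ ≤ m →
    ∀ (T : ℝ), 0 < T →
    ∀ (u : ℝ → R3 → R3) (p : ℝ → R3 → ℝ),
      IsClassicalNSSolutionOn (Ico 0 T) ν 0 u p → IsLerayHopfOn T ν 0 (u 0) u →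
      HasRapidSpatialDecay (u 0) →
      (∀ x : R3, u 0 (rotZ (2 * Real.pi / m) x) = rotZ (2 * Real.pi / m) (u 0 x)) →
      eLpNorm (u 0) 3 volume ≤ ENNReal.ofReal (K * ν) →
        HasSmoothExtensionPast ν 0 u T

/-- **Residual hypothesis (OPEN PROBLEM, not claimed):** axisymmetric-with-swirl regularity in the `L³`
class, local-Leray form — for `ν > 0`, a weakly divergence-free `a ∈ L³(ℝ³)` which is a.e.-axisymmetric
about some vertical axis, and any local Leray solution `(U, P)` with datum `a` (Jia–Šverák's `𝒩(a)`),
every point `(t₀, x₀)`, `t₀ > 0`, has a backward cylinder on which `U` is essentially bounded. -/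
def AxisymL3LerayRegular : Prop :=
  ∀ (ν : ℝ), 0 < ν → ∀ (ξ : R3) (a : R3 → R3) (U : ℝ → R3 → R3) (P : ℝ → R3 → ℝ),
    ξ 2 = 0 → MemLp a 3 volume → IsWeaklyDivFree a → IsAEAxisymmetricAbout ξ a →
    IsLocalLeraySolution ν a U P →
    ∀ (t₀ : ℝ) (x₀ : R3), 0 < t₀ → ∃ r : ℝ, 0 < r ∧
      eLpNorm (uncurry U) ∞ (volume.restrict (parabolicCylinder r ((t₀ : ℝ), x₀))) < ∞

/-! ## Kernel glue to the census rows -/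

/-- **Row F13mLarge ⇒ the cell** (the budget hypothesis is dropped). -/
theorem row_F13mLargeL3_of_row_F13mLarge (h : Row_F13mLarge) : Row_F13mLargeL3 := by
  obtain ⟨m₀, hm₀⟩ := h
  intro ν K hν
  exact ⟨m₀, fun m hm T hT u p hcl hLH hdec hsym _ => hm₀ m hm ν T hν hT u p hcl hLH hdec hsym⟩

/-- `‖iteratedFDeriv ℝ 0 f x‖ = ‖f x‖`: the order-zero clause of rapid decay is a pointwise bound. -/
theorem exists_norm_le_of_hasRapidSpatialDecay {f : R3 → R3} (h : HasRapidSpatialDecay f) :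
    ∃ C : ℝ, ∀ x, ‖f x‖ ≤ C := by
  obtain ⟨C, hC⟩ := h 0 0
  refine ⟨C, fun x => ?_⟩
  have := hC x
  simpa [norm_iteratedFDeriv_zero] using this

/-- **The cell ⇒ Row F5** (calibration, lens «wuc»: axisymmetric regularity in the Clay class is a
CONSEQUENCE of the budgeted large-order cell — an axisymmetric datum is `C_m`-symmetric for every `m`,
and a rapidly decaying Leray–Hopf datum has a finite `L³` budget). -/
theorem row_F5_of_row_F13mLargeL3 (h : Row_F13mLargeL3) : Row_F5 := by
  intro ν T hν hT u p hcl hLH hdec _ hax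
  -- the datum is in `L³`
  have h2 : MemLp (u 0) 2 volume := hLH.memLp 0 ⟨le_rfl, hT.le⟩
  obtain ⟨C, hC⟩ := exists_norm_le_of_hasRapidSpatialDecay hdec
  have h3 : MemLp (u 0) 3 volume := memLp_three_of_memLp_two_of_norm_le h2 hC
  -- its budget
  set K : ℝ := (eLpNorm (u 0) 3 volume).toReal / ν with hK
  have hbudget : eLpNorm (u 0) 3 volume ≤ ENNReal.ofReal (K * ν) := by
    rw [hK, div_mul_cancel₀ _ hν.ne', ENNReal.ofReal_toReal h3.eLpNorm_ne_top]
  obtain ⟨m₀, hm₀⟩ := h ν K hν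
  have hsym : ∀ x : R3, u 0 (rotZ (2 * Real.pi / m₀) x) = rotZ (2 * Real.pi / m₀) (u 0 x) :=
    fun x => hax 0 ⟨le_rfl, hT⟩ (2 * Real.pi / m₀) x
  exact hm₀ m₀ le_rfl T hT u p hcl hLH hdec hsym hbudget


/-! ## S1 — the normalised bad sequence (PROVED) -/

/-- **S1 (GLUE — normalised bad sequence; PROVED from tree theorems).**  If the cell fails at `(ν, K)`, there are orders
`m_j → ∞`, horizontal centres `c_j`, data `a_j ∈ L³` (weakly divergence free, `‖a_j‖₃ ≤ Kν`,
`C_{m_j}`-equivariant about the vertical axis through `c_j`) and local Leray solutions `(w_j, q_j) ∈ 𝒩(a_j)`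
each essentially unbounded on every backward cylinder at `(1, 0)`.  Every ingredient is a tree theorem:
choice of a bad solution at order `m_j ≥ j`; `isKatoSolutionOn_of_classical`;
`exists_singularPoint_of_classical_of_not_hasSmoothExtensionPast` (singular point `(T_j, x_j)`);
`kato_local_rescale_translate` with `λ_j = √T_j`, `x₀ = -x_j` (singular point ↦ `(1, 0)`, axis ↦ the
vertical line through `c_j = -x_j^h/λ_j`, `L³` norm unchanged: `eLpNorm_three_rescaleData`);
`eLpNorm_top_uncurry_rescale_translate` (singular cylinders transported);
`leray_solution_exists_ae_eq_kato_holds` (a local Leray solution a.e. equal to the Kato solution on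
`(0, 1) × ℝ³`, hence singular at `(1, 0)`: `eLpNorm_top_parabolicCylinder_eq_top_of_small`). -/
theorem normalisedBadSequence {ν K : ℝ} (hν : 0 < ν)
    (hbad : ∀ m₀ : ℕ, ∃ m : ℕ, m₀ ≤ m ∧ ∃ T : ℝ, 0 < T ∧
      ∃ (u : ℝ → R3 → R3) (p : ℝ → R3 → ℝ),
        IsClassicalNSSolutionOn (Ico 0 T) ν 0 u p ∧ IsLerayHopfOn T ν 0 (u 0) u ∧
        HasRapidSpatialDecay (u 0) ∧
        (∀ x : R3, u 0 (rotZ (2 * Real.pi / m) x) = rotZ (2 * Real.pi / m) (u 0 x)) ∧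
        eLpNorm (u 0) 3 volume ≤ ENNReal.ofReal (K * ν) ∧ ¬ HasSmoothExtensionPast ν 0 u T) :
    ∃ (m : ℕ → ℕ) (c : ℕ → R3) (a : ℕ → R3 → R3) (w : ℕ → ℝ → R3 → R3) (q : ℕ → ℝ → R3 → ℝ),
      Tendsto m atTop atTop ∧ (∀ j, c j 2 = 0) ∧
      (∀ j, MemLp (a j) 3 volume ∧ IsWeaklyDivFree (a j) ∧
        eLpNorm (a j) 3 volume ≤ ((K * ν).toNNReal : ℝ≥0∞)) ∧
      (∀ j, IsLocalLeraySolution ν (a j) (w j) (q j)) ∧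
      (∀ j, IsCyclicEquivariantAbout (m j) (c j) (a j)) ∧
      (∀ j (r : ℝ), 0 < r →
        eLpNorm (uncurry (w j)) ∞ (volume.restrict (parabolicCylinder r ((1 : ℝ), (0 : R3)))) = ∞) := by
  classical
  -- bad solutions at orders `m_j ≥ j`
  choose m hm T hT u p hcl hLH hdec hsym hbud hext using hbad
  -- they are Kato solutions with a singular point `(T_j, x_j)`
  have hK : ∀ j, IsKatoSolutionOn (T j) ν (u j 0) (u j) := fun j =>
    isKatoSolutionOn_of_classical hν (hT j) (hcl j) (hLH j) (hdec j)
  have hsingT : ∀ j, ∃ x₀ : R3, ∀ r : ℝ, 0 < r →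
      eLpNorm (uncurry (u j)) ∞ (volume.restrict (parabolicCylinder r ((T j : ℝ), x₀))) = ∞ := by
    intro j
    obtain ⟨x₀, hx₀⟩ := exists_singularPoint_of_classical_of_not_hasSmoothExtensionPast hν (hT j)
      (hcl j) (hLH j) (hdec j) (hext j)
    exact ⟨x₀, fun r hr => eLpNorm_top_parabolicCylinder_eq_top_of_small (hT j) hx₀ hr⟩
  choose x hx using hsingT
  -- scales `λ_j = √T_j`
  set lam : ℕ → ℝ := fun j => Real.sqrt (T j) with hlam_def
  have hlam : ∀ j, 0 < lam j := fun j => Real.sqrt_pos.2 (hT j)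
  have hlam2 : ∀ j, lam j ^ 2 = T j := fun j => Real.sq_sqrt (hT j).le
  -- normalised data and Kato solutions on `[0, 1)`
  set a : ℕ → R3 → R3 := fun j => rescaleData (lam j) fun y => u j 0 (y - -x j) with ha_def
  set v : ℕ → ℝ → R3 → R3 := fun j t y => lam j • u j (lam j ^ 2 * t) (lam j • y - -x j) with hv_def
  have hK1 : ∀ j, IsKatoSolutionOn 1 ν (a j) (v j) := by
    intro j
    obtain ⟨h1, h2, h3, h4⟩ := kato_local_rescale_translate (hK j).mild (hK j).continuousInLpOn
      (hK j).initial (hK j).aestronglyMeasurable (hlam j) (-x j)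
    have h1T : T j / lam j ^ 2 = 1 := by rw [hlam2, div_self (hT j).ne']
    rw [h1T] at h1 h2 h4
    exact ⟨h1, h2, h3, h4⟩
  have ha3 : ∀ j, MemLp (a j) 3 volume := fun j => by
    have h := (hK1 j).memLp (t := 0) ⟨le_rfl, one_pos⟩
    rwa [(hK1 j).initial] at h
  have hdiv : ∀ j, IsWeaklyDivFree (a j) := fun j => by
    have h := (hK1 j).mild.1 0 ⟨le_rfl, one_pos⟩
    rwa [(hK1 j).initial] at h
  have hnorm : ∀ j, eLpNorm (a j) 3 volume ≤ ((K * ν).toNNReal : ℝ≥0∞) := fun j => by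
    have hmeas : AEStronglyMeasurable (u j 0) volume := ((hLH j).memLp 0 ⟨le_rfl, (hT j).le⟩).1
    have e1 : eLpNorm (a j) 3 volume = eLpNorm (fun y => u j 0 (y - -x j)) 3 volume :=
      eLpNorm_three_rescaleData _ (hlam j)
    have e2 : eLpNorm (fun y => u j 0 (y - -x j)) 3 volume = eLpNorm (u j 0) 3 volume :=
      eLpNorm_comp_measurePreserving (g := u j 0) (f := fun y : R3 => y - -x j) hmeas
        (measurePreserving_sub_right volume (-x j))
    rw [e1, e2]
    exact hbud j
  -- local Leray solutions a.e. equal to the normalised Kato solutions on `(0, 1) × ℝ³`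
  have hLer : ∀ j, ∃ (w : ℝ → R3 → R3) (q : ℝ → R3 → ℝ), IsLocalLeraySolution ν (a j) w q ∧
      uncurry w =ᵐ[volume.restrict (Ioo 0 1 ×ˢ (univ : Set R3))] uncurry (v j) := fun j =>
    leray_solution_exists_ae_eq_kato_holds hν one_pos (ha3 j) (hdiv j) (hK1 j)
  choose w q hw hae using hLer
  -- the normalised Kato solutions are singular at `(1, 0)`
  have hvsing : ∀ j (r : ℝ), 0 < r →
      eLpNorm (uncurry (v j)) ∞ (volume.restrict (parabolicCylinder r ((1 : ℝ), (0 : R3)))) = ∞ := by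
    intro j r hr
    have h := eLpNorm_top_uncurry_rescale_translate (u j) (hlam j) (-x j) r 1 0
    have e1 : (lam j ^ 2 * 1 : ℝ) = T j := by rw [mul_one, hlam2]
    have e2 : lam j • (0 : R3) - -x j = x j := by rw [smul_zero, sub_neg_eq_add, zero_add]
    rw [e1, e2, hx j (lam j * r) (mul_pos (hlam j) hr),
      ENNReal.mul_top (enorm_ne_zero.2 (hlam j).ne')] at h
    exact h
  -- hence so are the local Leray solutions
  have hwsing : ∀ j (r : ℝ), 0 < r →
      eLpNorm (uncurry (w j)) ∞ (volume.restrict (parabolicCylinder r ((1 : ℝ), (0 : R3)))) = ∞ := by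
    intro j r hr
    refine eLpNorm_top_parabolicCylinder_eq_top_of_small one_pos (fun ρ hρ hρ1 => ?_) hr
    rw [eLpNorm_congr_ae (ae_restrict_of_ae_restrict_of_subset
      (parabolicCylinder_one_subset_strip hρ1) (hae j))]
    exact hvsing j ρ hρ
  -- the package
  refine ⟨m, fun j => axisCentre (lam j) (x j), a, w, q, ?_, fun j => rfl, fun j =>
    ⟨ha3 j, hdiv j, hnorm j⟩, hw, fun j => ?_, hwsing⟩
  · exact tendsto_atTop_atTop.2 fun b => ⟨b, fun j hj => le_trans hj (hm j)⟩
  · -- equivariance about the moved axis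
    intro y
    show lam j • u j 0 (lam j • (axisCentre (lam j) (x j) +
        rotZ (2 * Real.pi / m j) (y - axisCentre (lam j) (x j))) - -x j) =
      rotZ (2 * Real.pi / m j) (lam j • u j 0 (lam j • y - -x j))
    rw [normalise_conj_rotZ (hlam j).ne', hsym j, rotZ_smul']

/-! ## S2 — profile rigidity (from `LargeOrderRigidity`) -/

/-- **S2 (THE LEVER — profile rigidity at diverging cyclic order); rev 2: PROVED from the stubs (P), (V)
by `profileRigidity_of` and the proved (Z).**  Let `a_j` be `L³` fields with
`‖a_j‖₃ ≤ M`, `C_{m_j}`-equivariant about vertical axes through horizontal centres `c_j`, with `m_j → ∞`,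
converging weakly (against test fields) to `f ∈ L³`.  Then `f` is a.e.-axisymmetric about some vertical
axis.  Trichotomy (after subsequences) on `s_j = |c_j|` and the orbit spacing `d_j = 2 s_j sin(π/m_j)`:
(i) `s_j` bounded, `c_j → ξ`: for every `θ` the rotations by `2πk_j/m_j → θ` about `c_j` converge locally
uniformly to the rotation by `θ` about `ξ`; equivariance passes to the weak limit ⇒ axisymmetric about `ξ`;
(ii) `s_j → ∞`, `d_j` bounded: powers `k_j` with angle `2πk_j/m_j → 0` and chord `→ τ ≠ 0` horizontal
exist; the affine rotations converge to the translation by `τ`; `f` is `τ`-periodic and in `L³`, so `f = 0`;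
(iii) `d_j → ∞`: for a test field `φ` supported in `B(x, ρ)` the `m_j` rotated copies
`R^k φ(A^{-k} ·)` have pairwise disjoint supports for large `j` and pair identically with `a_j`, so
`m_j |⟨a_j, φ⟩| ≤ M ‖Σ_k φ_k‖_{3/2} = M m_j^{2/3} ‖φ‖_{3/2}`, i.e. `⟨a_j, φ⟩ → 0` and `f = 0`.
(`0` is axisymmetric.)  The BUDGET `M` is used in (iii) only; without it rings of `m` far-apart copies
(g4 `not_row_F13m_of_farFieldRobustBlowup`) show no rigidity can hold. -/
theorem profileRigidity {M : ℝ≥0} {m : ℕ → ℕ} {c : ℕ → R3} {a : ℕ → R3 → R3} {f : R3 → R3}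
    (hm : Tendsto m atTop atTop) (hc : ∀ j, c j 2 = 0)
    (ha : ∀ j, MemLp (a j) 3 volume ∧ eLpNorm (a j) 3 volume ≤ (M : ℝ≥0∞))
    (hsym : ∀ j, IsCyclicEquivariantAbout (m j) (c j) (a j))
    (hf : MemLp f 3 volume)
    (hweak : ∀ φ : R3 → R3, FunctionSpaces.IsTestFunctionOn (⊤ : Opens R3) φ →
      Tendsto (fun j => ∫ x, ⟪a j x, φ x⟫) atTop (𝓝 (∫ x, ⟪f x, φ x⟫))) :
    ∃ ξ : R3, ξ 2 = 0 ∧ IsAEAxisymmetricAbout ξ f :=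
  profileRigidity_of weakLimitEquivariance_holds farOrbitVanishing_holds periodicL3Zero_holds hm hc ha hsym
    hf hweak

/-! ## The theorem of the line -/

/-- **LINE 13: axisymmetric `L³` regularity ⇒ the budgeted large-order cell.**  Kernel-checked
composition of S1, the tree's weak-`L³` stability theorem with stability of singular points
(`leray_solution_L3_weak_stability_holds`, PROVED in the tree), S2 and the residual. -/
theorem row_F13mLargeL3_of (hR : AxisymL3LerayRegular) : Row_F13mLargeL3 := by
  intro ν K hν
  by_contra h
  push Not at h
  -- S1: the normalised bad sequence
  obtain ⟨m, c, a, w, q, hm, hc, ha, hw, hsym, hsing⟩ := normalisedBadSequence (K := K) hν h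
  -- weak `L³` stability of local Leray solutions with stability of singular points (tree theorem)
  obtain ⟨σ, a', U, P, hσ, ha'3, ha'div, ha'le, hweak, hU, hstab, -⟩ :=
    leray_solution_L3_weak_stability_holds hν (K * ν).toNNReal a w q ha hw
  -- the limit solution is singular at `(1, 0)`
  have hUsing : ∀ r : ℝ, 0 < r →
      eLpNorm (uncurry U) ∞ (volume.restrict (parabolicCylinder r ((1 : ℝ), (0 : R3)))) = ∞ :=
    hstab 1 0 one_pos (fun k r hr => hsing (σ k) r hr)
  -- S2: the weak limit is a.e.-axisymmetric about some vertical axis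
  obtain ⟨ξ, hξ, hax⟩ := profileRigidity (M := (K * ν).toNNReal) (m := m ∘ σ) (c := c ∘ σ)
    (a := a ∘ σ) (f := a') (hm.comp hσ.tendsto_atTop) (fun j => hc (σ j))
    (fun j => ⟨(ha (σ j)).1, (ha (σ j)).2.2⟩) (fun j => hsym (σ j)) ha'3 hweak
  -- the residual: no singular point — contradiction
  obtain ⟨r, hr, hfin⟩ := hR ν hν ξ a' U P hξ ha'3 ha'div hax hU 1 0 one_pos
  exact hfin.ne (hUsing r hr)

/-- **The sandwich** (lens «wuc», both directions kernel-checked modulo S1/S2):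
`AxisymL3LerayRegular ⟹ Row_F13mLargeL3 ⟹ Row_F5`. -/
theorem row_F5_of_axisymL3LerayRegular (hR : AxisymL3LerayRegular) : Row_F5 :=
  row_F5_of_row_F13mLargeL3 (row_F13mLargeL3_of hR)



end Summit.NavierStokesRegularity.NavierStokesRegularity.Theorems.ScenarioCensus.RowF13mLargeL3

end
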